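import Mathlib.Analysis.Calculus.ContDiff.Bounds
import Mathlib.Analysis.Calculus.ContDiff.RestrictScalars
import Mathlib.Analysis.Calculus.IteratedDeriv.Lemmas
import Mathlib.Analysis.SpecialFunctions.ExpDeriv
import Mathlib.Analysis.Complex.RealDeriv
import Mathlib.Analysis.Distribution.TemperateGrowth
import Mathlib.Analysis.Distribution.SchwartzSpace.Basic
import Literature.Analysis.Distribution.ExpLinearEstimates
import HarnessLib

/-!
# Exponentially cut-off Schwartz functions `χ e^{ℓ} q` and their differentiation in the exponent

Topic `Literature/Analysis/Distribution`. Second layer (on top of `ExpLinearEstimates` and next to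
`SmoothCutoff`) of the machinery for the Fourier–Laplace representation of cone-supported tempered
distributions (`Literature.Analysis.Distribution.fourierLaplace_coneSupport`, Hörmander Thm. 7.4.2,
Streater–Wightman Thms. 2-6–2-9), where `F(ζ) = ⟨u, χ e^{-2πi⟨·,ζ⟩}⟩` with `χ` a cone cutoff:

* `dsup n f x = max_{i ≤ n} ‖Dⁱf(x)‖` (the size of the `n`-jet) with its Leibniz rule
  `dsup_mul_le` and chain-rule bounds for an entire function of a real-linear complex form
  (`norm_iteratedFDeriv_comp_clm_le`, `dsup_cexp_comp_le`, `dsup_clm_le`,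
  `dsup_cexp_sub_one_sub_comp_le`: the jet of `e^{ℓ} - 1 - ℓ` is `O(‖ℓ‖²)`);
* `BddCutoff E`: smooth `χ : E → ℂ` with all jets bounded (`BddCutoff.ofReal` packages the
  real cutoffs of `exists_smooth_cutoff`), admissible forms `BddCutoff.IsAdmissible χ ℓ`
  (`Re ℓ ≤ C₀ - c‖·‖` on `supp χ`), and the **master estimate** `BddCutoff.master_estimate`:
  `‖x‖^k ‖Dⁿ(χ e^{ℓ} q)(x)‖ ≤ K (1 + ‖ℓ‖)ⁿ B` when the `n`-jet of `q` is
  `≤ B (1+‖x‖)^m e^{(c/2)‖x‖}`;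
* the Schwartz functions `BddCutoff.expMul χ ℓ hq = χ e^{ℓ} q` (`q` of temperate growth) and the
  **exponential family** `BddCutoff.expFamily χ Λ p = χ e^{Λ p}` of a `ℂ`-linear family of forms
  `Λ : P →L[ℂ] (E →L[ℝ] ℂ)`, with uniform seminorm bounds (`seminorm_expMul_le`,
  `seminorm_expFamily_le`: polynomial in `‖Λ p‖`);
* `BddCutoff.hasFDerivAt_comp_expFamily`: for every continuous linear `U : 𝓢(E, ℂ) →L[ℂ] G`,
  `p ↦ U (χ e^{Λ p})` is (complex) differentiable at admissible `p₀` with derivative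
  `w ↦ U (χ e^{Λ p₀} Λ w)` — the holomorphy of the Fourier–Laplace transform;
* `BddCutoff.pow_mul_norm_iteratedFDeriv_cexp_sub_one_mul_le`: switching the weight on,
  `χ (e^{tℓ} - 1) g`, costs `O(t)` in every Schwartz seminorm (`g ∈ 𝓢`, `t ∈ [0,1]`) — the
  boundary-value limit on the test-function side;
* `exists_seminorm_bound_of_clm`: a continuous linear map out of `𝓢` into a normed space is
  bounded by finitely many Schwartz seminorms.

## References

* L. Hörmander, *The Analysis of Linear Partial Differential Operators I*, 2nd ed. (1990),
  §7.4, Thm. 7.4.2 and its proof, Remark after Thm. 7.4.3 (pdf pp. 160–163). [HormanderALPDO1]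

## Mathlib / tree

Used: `norm_iteratedFDeriv_mul_le`, `ContinuousLinearMap.iteratedFDeriv_comp_right`,
`ContDiffAt.restrictScalars_iteratedFDeriv`, `norm_iteratedFDeriv_eq_norm_iteratedDeriv`,
`iteratedDeriv_cexp_const_mul`, `SchwartzMap.seminorm_le_bound`, `Seminorm.bound_of_continuous`
with `schwartz_withSeminorms`, `SchwartzMap.one_add_le_sup_seminorm_apply`,
`LinearMap.continuous_of_finiteDimensional`, `hasFDerivAt_iff_isLittleO_nhds_zero`,
`Asymptotics.isLittleO_norm_pow_id`; tree: `norm_cexp_sub_one_le`, `norm_cexp_sub_one_sub_le`,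
`contDiff_cexp_comp`, `one_add_pow_mul_exp_neg_le` (`ExpLinearEstimates`).
-/

noncomputable section

open scoped ContDiff
open Complex Set Filter Asymptotics
open scoped SchwartzMap Topology

namespace Literature.Analysis.Distribution

variable {E : Type*} [NormedAddCommGroup E] [NormedSpace ℝ E]
variable {F : Type*} [NormedAddCommGroup F] [NormedSpace ℝ F]

/-! ### `dsup`: the maximum of the first `n` derivative norms at a point -/

/-- `dsup n f x = max_{0 ≤ i ≤ n} ‖iteratedFDeriv ℝ i f x‖`, the size of the `n`-jet of `f` at
`x`. [folklore] -/
def dsup (n : ℕ) (f : E → F) (x : E) : ℝ :=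
  (Finset.range (n + 1)).sup' ⟨0, by simp⟩ fun i => ‖iteratedFDeriv ℝ i f x‖

/-- Each derivative norm of order `i ≤ n` is bounded by `dsup n`. [folklore] -/
theorem norm_iteratedFDeriv_le_dsup {n i : ℕ} (hi : i ≤ n) (f : E → F) (x : E) :
    ‖iteratedFDeriv ℝ i f x‖ ≤ dsup n f x :=
  Finset.le_sup' (fun i => ‖iteratedFDeriv ℝ i f x‖) (by simpa [Nat.lt_succ_iff] using hi)

/-- The function value is bounded by `dsup n`. [folklore] -/
theorem norm_le_dsup (n : ℕ) (f : E → F) (x : E) : ‖f x‖ ≤ dsup n f x := by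
  have h := norm_iteratedFDeriv_le_dsup (Nat.zero_le n) f x
  rwa [norm_iteratedFDeriv_zero] at h

/-- `dsup` is nonnegative. [folklore] -/
theorem dsup_nonneg (n : ℕ) (f : E → F) (x : E) : 0 ≤ dsup n f x :=
  (norm_nonneg _).trans (norm_le_dsup n f x)

/-- `dsup n f x ≤ C` iff all derivative norms of order `≤ n` are `≤ C`. [folklore] -/
theorem dsup_le_iff {n : ℕ} {f : E → F} {x : E} {C : ℝ} :
    dsup n f x ≤ C ↔ ∀ i ≤ n, ‖iteratedFDeriv ℝ i f x‖ ≤ C := by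
  simp only [dsup, Finset.sup'_le_iff, Finset.mem_range, Nat.lt_succ_iff]

/-- `dsup` is monotone in the order. [folklore] -/
theorem dsup_mono {m n : ℕ} (h : m ≤ n) (f : E → F) (x : E) : dsup m f x ≤ dsup n f x :=
  dsup_le_iff.2 fun _ hi => norm_iteratedFDeriv_le_dsup (hi.trans h) f x

/-- `dsup` vanishes outside the topological support. [folklore] -/
theorem dsup_eq_zero_of_notMem_tsupport {n : ℕ} {f : E → F} {x : E} (hx : x ∉ tsupport f) :
    dsup n f x = 0 := by
  refine le_antisymm (dsup_le_iff.2 fun i _ => ?_) (dsup_nonneg n f x)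
  have : iteratedFDeriv ℝ i f x = 0 := by
    by_contra h
    exact hx (support_iteratedFDeriv_subset i (Function.mem_support.2 h))
  simp [this]

/-- The jet of a constant function: `dsup n c x ≤ ‖c‖`. [folklore] -/
theorem dsup_const_le (n : ℕ) (c : F) (x : E) : dsup n (fun _ : E => c) x ≤ ‖c‖ := by
  refine dsup_le_iff.2 fun i _ => ?_
  rcases i with _ | i
  · simp
  · rw [iteratedFDeriv_const_of_ne (by omega)]
    simp

/-! ### Leibniz: `dsup` of a product -/

/-- **Leibniz bound for the jet of a product**: `dsup n (f g) ≤ 2^n dsup n f · dsup n g`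
(from `‖D^i(fg)‖ ≤ ∑_{j} C(i,j) ‖D^j f‖ ‖D^{i-j} g‖` and `∑_j C(i,j) = 2^i ≤ 2^n`). [folklore] -/
theorem dsup_mul_le {f g : E → ℂ} (hf : ContDiff ℝ ∞ f) (hg : ContDiff ℝ ∞ g) (n : ℕ) (x : E) :
    dsup n (fun y => f y * g y) x ≤ 2 ^ n * dsup n f x * dsup n g x := by
  refine dsup_le_iff.2 fun i hi => ?_
  have hL := norm_iteratedFDeriv_mul_le hf hg x (n := i) (mod_cast le_top)
  refine hL.trans ?_
  have h0f := dsup_nonneg n f x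
  have h0g := dsup_nonneg n g x
  calc ∑ j ∈ Finset.range (i + 1),
        (i.choose j : ℝ) * ‖iteratedFDeriv ℝ j f x‖ * ‖iteratedFDeriv ℝ (i - j) g x‖
      ≤ ∑ j ∈ Finset.range (i + 1), (i.choose j : ℝ) * dsup n f x * dsup n g x := by
        refine Finset.sum_le_sum fun j hj => ?_
        have hj' : j ≤ n := (Nat.lt_succ_iff.1 (Finset.mem_range.1 hj)).trans hi
        gcongr
        · exact norm_iteratedFDeriv_le_dsup hj' f x
        · exact norm_iteratedFDeriv_le_dsup (by omega) g x
    _ = (2 : ℝ) ^ i * dsup n f x * dsup n g x := by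
        rw [← Finset.sum_mul, ← Finset.sum_mul]
        congr 2
        have := Nat.sum_range_choose i
        exact_mod_cast this
    _ ≤ 2 ^ n * dsup n f x * dsup n g x := by
        gcongr
        norm_num


/-! ### Chain rule: an entire function of a real-linear complex form -/

/-- **Chain-rule bound.** For an entire `f : ℂ → ℂ` and a real-linear form `ℓ : E →L[ℝ] ℂ`,
`‖D^i (f ∘ ℓ)(x)‖ ≤ |f^{(i)}(ℓ x)| ‖ℓ‖^i` (the `i`-th Fréchet derivative of `f ∘ ℓ` is
`f^{(i)}(ℓ x) · ℓ^{⊗ i}`). [folklore] -/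
theorem norm_iteratedFDeriv_comp_clm_le {f : ℂ → ℂ} (hf : ContDiff ℂ ∞ f) (ℓ : E →L[ℝ] ℂ)
    (i : ℕ) (x : E) :
    ‖iteratedFDeriv ℝ i (fun y => f (ℓ y)) x‖ ≤ ‖iteratedDeriv i f (ℓ x)‖ * ‖ℓ‖ ^ i := by
  have hfR : ContDiff ℝ ∞ f := hf.restrict_scalars ℝ
  have h1 : iteratedFDeriv ℝ i (fun y => f (ℓ y)) x
      = (iteratedFDeriv ℝ i f (ℓ x)).compContinuousLinearMap fun _ => ℓ :=
    ℓ.iteratedFDeriv_comp_right hfR x (mod_cast le_top)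
  have h2 : ‖iteratedFDeriv ℝ i f (ℓ x)‖ = ‖iteratedDeriv i f (ℓ x)‖ := by
    have h3 := (hf.of_le (mod_cast le_top) : ContDiff ℂ i f).contDiffAt (x := ℓ x)
      |>.restrictScalars_iteratedFDeriv (𝕜 := ℝ)
    simp only [Function.comp_apply] at h3
    rw [← h3, ContinuousMultilinearMap.norm_restrictScalars, norm_iteratedFDeriv_eq_norm_iteratedDeriv]
  rw [h1, ← h2]
  refine (ContinuousMultilinearMap.norm_compContinuousLinearMap_le _ _).trans ?_
  rw [Fin.prod_const]

/-- All iterated derivatives of the complex exponential are the exponential. [folklore] -/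
theorem iteratedDeriv_cexp (i : ℕ) : iteratedDeriv i cexp = cexp := by
  have := iteratedDeriv_cexp_const_mul i 1
  simpa using this

/-- **Jet of `exp ∘ ℓ`.** `dsup n (exp ∘ ℓ)(x) ≤ (1 + ‖ℓ‖)^n e^{Re ℓ(x)}`. [folklore] -/
theorem dsup_cexp_comp_le (ℓ : E →L[ℝ] ℂ) (n : ℕ) (x : E) :
    dsup n (fun y => cexp (ℓ y)) x ≤ (1 + ‖ℓ‖) ^ n * Real.exp (ℓ x).re := by
  refine dsup_le_iff.2 fun i hi => ?_
  refine (norm_iteratedFDeriv_comp_clm_le contDiff_exp ℓ i x).trans ?_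
  rw [iteratedDeriv_cexp, Complex.norm_exp, mul_comm]
  gcongr
  calc ‖ℓ‖ ^ i ≤ (1 + ‖ℓ‖) ^ i := by gcongr; linarith [norm_nonneg ℓ]
    _ ≤ (1 + ‖ℓ‖) ^ n := pow_le_pow_right₀ (by linarith [norm_nonneg ℓ]) hi

/-- Iterated derivatives of the identity of `ℂ`: `s`, then `1`, then `0`. [folklore] -/
theorem norm_iteratedDeriv_id_le (i : ℕ) (s : ℂ) :
    ‖iteratedDeriv i (fun t : ℂ => t) s‖ ≤ if i = 0 then ‖s‖ else if i = 1 then 1 else 0 := by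
  rcases i with _ | i
  · simp
  rcases i with _ | i
  · simp
  · have : iteratedDeriv (i + 2) (fun t : ℂ => t) s = 0 := by
      rw [show i + 2 = (i + 1) + 1 by ring, iteratedDeriv_succ', deriv_id'', iteratedDeriv_const]
      simp
    simp [this]

/-- **Jet of a linear form.** `dsup n ℓ (x) ≤ ‖ℓ‖ (1 + ‖x‖)` (the value is `≤ ‖ℓ‖ ‖x‖`, the first
derivative is `ℓ`, the higher ones vanish). [folklore] -/
theorem dsup_clm_le (ℓ : E →L[ℝ] ℂ) (n : ℕ) (x : E) :
    dsup n (fun y => ℓ y) x ≤ ‖ℓ‖ * (1 + ‖x‖) := by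
  refine dsup_le_iff.2 fun i _ => ?_
  have h := norm_iteratedFDeriv_comp_clm_le (f := fun t : ℂ => t) contDiff_id ℓ i x
  refine h.trans ((mul_le_mul_of_nonneg_right (norm_iteratedDeriv_id_le i (ℓ x))
    (by positivity)).trans ?_)
  split_ifs with h0 h1
  · subst h0
    simpa using (ℓ.le_opNorm x).trans (by nlinarith [norm_nonneg ℓ, norm_nonneg x])
  · subst h1
    nlinarith [norm_nonneg ℓ, norm_nonneg x]
  · simp only [zero_mul]
    positivity

/-! ### The exponential remainders `e^s - 1` and `e^s - 1 - s` -/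

/-- The derivative of `s ↦ e^s - 1 - s` is `s ↦ e^s - 1`. [folklore] -/
theorem deriv_cexp_sub_one_sub : deriv (fun s : ℂ => cexp s - 1 - s) = fun s => cexp s - 1 := by
  funext s
  exact (((Complex.hasDerivAt_exp s).sub_const (1 : ℂ)).sub (hasDerivAt_id s)).deriv

/-- The derivative of `s ↦ e^s - 1` is `exp`. [folklore] -/
theorem deriv_cexp_sub_one : deriv (fun s : ℂ => cexp s - 1) = cexp := by
  funext s
  exact ((Complex.hasDerivAt_exp s).sub_const (1 : ℂ)).deriv

/-- Iterated derivatives of `s ↦ e^s - 1`: itself for `i = 0`, `exp` for `i ≥ 1`. [folklore] -/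
theorem iteratedDeriv_cexp_sub_one (i : ℕ) (s : ℂ) :
    iteratedDeriv i (fun t : ℂ => cexp t - 1) s = if i = 0 then cexp s - 1 else cexp s := by
  rcases i with _ | i
  · simp
  · rw [iteratedDeriv_succ', deriv_cexp_sub_one, iteratedDeriv_cexp]
    simp

/-- Iterated derivatives of `s ↦ e^s - 1 - s`: itself, then `e^s - 1`, then `e^s`. [folklore] -/
theorem iteratedDeriv_cexp_sub_one_sub (i : ℕ) (s : ℂ) :
    iteratedDeriv i (fun t : ℂ => cexp t - 1 - t) s =
      if i = 0 then cexp s - 1 - s else if i = 1 then cexp s - 1 else cexp s := by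
  rcases i with _ | i
  · simp
  · rw [iteratedDeriv_succ', deriv_cexp_sub_one_sub, iteratedDeriv_cexp_sub_one]
    rcases i with _ | i <;> simp

/-- `s ↦ e^s - 1 - s` is entire. [folklore] -/
theorem contDiff_cexp_sub_one_sub : ContDiff ℂ ∞ fun t : ℂ => cexp t - 1 - t :=
  (contDiff_exp.sub contDiff_const).sub contDiff_id

/-- `s ↦ e^s - 1` is entire. [folklore] -/
theorem contDiff_cexp_sub_one : ContDiff ℂ ∞ fun t : ℂ => cexp t - 1 :=
  contDiff_exp.sub contDiff_const

/-- **Jet of the second-order exponential remainder.** For a real-linear form `ℓ`,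
`dsup n (e^{ℓ} - 1 - ℓ)(x) ≤ ‖ℓ‖² (1 + ‖x‖)² (1 + ‖ℓ‖)^n e^{‖ℓ‖ ‖x‖}`: every derivative carries a
factor `‖ℓ‖²`. [folklore] -/
theorem dsup_cexp_sub_one_sub_comp_le (ℓ : E →L[ℝ] ℂ) (n : ℕ) (x : E) :
    dsup n (fun y => cexp (ℓ y) - 1 - ℓ y) x ≤
      ‖ℓ‖ ^ 2 * (1 + ‖x‖) ^ 2 * (1 + ‖ℓ‖) ^ n * Real.exp (‖ℓ‖ * ‖x‖) := by
  have hℓ := norm_nonneg ℓ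
  have hx := norm_nonneg x
  have hs : ‖ℓ x‖ ≤ ‖ℓ‖ * ‖x‖ := ℓ.le_opNorm x
  have hre : Real.exp (ℓ x).re ≤ Real.exp (‖ℓ‖ * ‖x‖) :=
    Real.exp_le_exp.2 ((Complex.re_le_norm _).trans hs)
  have h1ℓ : (1 : ℝ) ≤ 1 + ‖ℓ‖ := by linarith
  refine dsup_le_iff.2 fun i hi => ?_
  refine (norm_iteratedFDeriv_comp_clm_le contDiff_cexp_sub_one_sub ℓ i x).trans ?_
  rw [iteratedDeriv_cexp_sub_one_sub]
  split_ifs with h0 h1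
  · subst h0
    simp only [pow_zero, mul_one]
    refine (norm_cexp_sub_one_sub_le (ℓ x)).trans ?_
    have hmax : max (ℓ x).re 0 ≤ ‖ℓ‖ * ‖x‖ :=
      max_le ((Complex.re_le_norm _).trans hs) (by positivity)
    calc ‖ℓ x‖ ^ 2 * Real.exp (max (ℓ x).re 0)
        ≤ (‖ℓ‖ * ‖x‖) ^ 2 * Real.exp (‖ℓ‖ * ‖x‖) := by gcongr
      _ = ‖ℓ‖ ^ 2 * ‖x‖ ^ 2 * 1 * Real.exp (‖ℓ‖ * ‖x‖) := by ring
      _ ≤ ‖ℓ‖ ^ 2 * (1 + ‖x‖) ^ 2 * (1 + ‖ℓ‖) ^ n * Real.exp (‖ℓ‖ * ‖x‖) := by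
          gcongr
          · linarith
          · exact one_le_pow₀ h1ℓ
  · subst h1
    simp only [pow_one]
    refine (mul_le_mul_of_nonneg_right (norm_cexp_sub_one_le (ℓ x)) hℓ).trans ?_
    have hmax : max (ℓ x).re 0 ≤ ‖ℓ‖ * ‖x‖ :=
      max_le ((Complex.re_le_norm _).trans hs) (by positivity)
    calc ‖ℓ x‖ * Real.exp (max (ℓ x).re 0) * ‖ℓ‖
        ≤ (‖ℓ‖ * ‖x‖) * Real.exp (‖ℓ‖ * ‖x‖) * ‖ℓ‖ := by gcongr
      _ = ‖ℓ‖ ^ 2 * (‖x‖ * 1) * 1 * Real.exp (‖ℓ‖ * ‖x‖) := by ring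
      _ ≤ ‖ℓ‖ ^ 2 * (1 + ‖x‖) ^ 2 * (1 + ‖ℓ‖) ^ n * Real.exp (‖ℓ‖ * ‖x‖) := by
          gcongr
          · nlinarith
          · exact one_le_pow₀ h1ℓ
  · -- `i ≥ 2`
    have hi2 : 2 ≤ i := by omega
    rw [Complex.norm_exp]
    obtain ⟨j, rfl⟩ : ∃ j, i = j + 2 := ⟨i - 2, by omega⟩
    calc Real.exp (ℓ x).re * ‖ℓ‖ ^ (j + 2)
        = ‖ℓ‖ ^ 2 * 1 * ‖ℓ‖ ^ j * Real.exp (ℓ x).re := by ring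
      _ ≤ ‖ℓ‖ ^ 2 * (1 + ‖x‖) ^ 2 * (1 + ‖ℓ‖) ^ n * Real.exp (‖ℓ‖ * ‖x‖) := by
          gcongr
          · nlinarith
          · calc ‖ℓ‖ ^ j ≤ (1 + ‖ℓ‖) ^ j := by gcongr; linarith
              _ ≤ (1 + ‖ℓ‖) ^ n := pow_le_pow_right₀ h1ℓ (by omega)

/-- **Jet of the first-order exponential remainder.** For a real-linear form `ℓ`,
`dsup n (e^{ℓ} - 1)(x) ≤ ‖ℓ‖ (1 + ‖x‖) (1 + ‖ℓ‖)^n e^{‖ℓ‖ ‖x‖}`. [folklore] -/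
theorem dsup_cexp_sub_one_comp_le (ℓ : E →L[ℝ] ℂ) (n : ℕ) (x : E) :
    dsup n (fun y => cexp (ℓ y) - 1) x ≤
      ‖ℓ‖ * (1 + ‖x‖) * (1 + ‖ℓ‖) ^ n * Real.exp (‖ℓ‖ * ‖x‖) := by
  have hℓ := norm_nonneg ℓ
  have hx := norm_nonneg x
  have hs : ‖ℓ x‖ ≤ ‖ℓ‖ * ‖x‖ := ℓ.le_opNorm x
  have h1ℓ : (1 : ℝ) ≤ 1 + ‖ℓ‖ := by linarith
  refine dsup_le_iff.2 fun i hi => ?_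
  refine (norm_iteratedFDeriv_comp_clm_le contDiff_cexp_sub_one ℓ i x).trans ?_
  rw [iteratedDeriv_cexp_sub_one]
  split_ifs with h0
  · subst h0
    simp only [pow_zero, mul_one]
    refine (norm_cexp_sub_one_le (ℓ x)).trans ?_
    have hmax : max (ℓ x).re 0 ≤ ‖ℓ‖ * ‖x‖ :=
      max_le ((Complex.re_le_norm _).trans hs) (by positivity)
    calc ‖ℓ x‖ * Real.exp (max (ℓ x).re 0) ≤ (‖ℓ‖ * ‖x‖) * Real.exp (‖ℓ‖ * ‖x‖) := by gcongr
      _ = ‖ℓ‖ * ‖x‖ * 1 * Real.exp (‖ℓ‖ * ‖x‖) := by ring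
      _ ≤ ‖ℓ‖ * (1 + ‖x‖) * (1 + ‖ℓ‖) ^ n * Real.exp (‖ℓ‖ * ‖x‖) := by
          gcongr
          · linarith
          · exact one_le_pow₀ h1ℓ
  · obtain ⟨j, rfl⟩ : ∃ j, i = j + 1 := ⟨i - 1, by omega⟩
    rw [Complex.norm_exp]
    calc Real.exp (ℓ x).re * ‖ℓ‖ ^ (j + 1) = ‖ℓ‖ * 1 * ‖ℓ‖ ^ j * Real.exp (ℓ x).re := by ring
      _ ≤ ‖ℓ‖ * (1 + ‖x‖) * (1 + ‖ℓ‖) ^ n * Real.exp (‖ℓ‖ * ‖x‖) := by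
          gcongr
          · linarith
          · calc ‖ℓ‖ ^ j ≤ (1 + ‖ℓ‖) ^ j := by gcongr; linarith
              _ ≤ (1 + ‖ℓ‖) ^ n := pow_le_pow_right₀ h1ℓ (by omega)
          · exact (Complex.re_le_norm _).trans hs


/-! ### Cutoffs with bounded derivatives and the master estimate -/

variable (E) in
/-- A **cutoff with bounded jets**: a smooth complex function on `E` all of whose derivatives are
bounded (`sup_x dsup n χ x < ∞` for every `n`). The cone cutoffs of Hörmander's proof of
Thm. 7.4.2/7.4.3 are of this kind. [cite: HormanderALPDO1, §7.4 proof of Thm 7.4.3] -/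
structure BddCutoff where
  /-- The underlying function. -/
  toFun : E → ℂ
  /-- Smoothness. -/
  smooth' : ContDiff ℝ ∞ toFun
  /-- Every jet is bounded. -/
  bdd' : ∀ n : ℕ, ∃ A : ℝ, ∀ x, dsup n toFun x ≤ A

namespace BddCutoff

/-- A cutoff is used as a function. -/
instance : CoeFun (BddCutoff E) fun _ => E → ℂ := ⟨BddCutoff.toFun⟩

/-- The zero cutoff. [folklore] -/
protected def zero : BddCutoff E where
  toFun := 0
  smooth' := contDiff_const
  bdd' n := ⟨0, fun x => le_of_eq (by
    refine le_antisymm (dsup_le_iff.2 fun i _ => ?_) (dsup_nonneg _ _ _)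
    simp)⟩

/-- A cutoff with bounded jets is smooth. [folklore] -/
theorem smooth (χ : BddCutoff E) : ContDiff ℝ ∞ χ := χ.smooth'

/-- Build a cutoff with bounded jets from bounds on the individual derivatives. [folklore] -/
def ofBounds (f : E → ℂ) (hf : ContDiff ℝ ∞ f)
    (h : ∀ n : ℕ, ∃ A : ℝ, ∀ x, ‖iteratedFDeriv ℝ n f x‖ ≤ A) : BddCutoff E where
  toFun := f
  smooth' := hf
  bdd' n := by
    choose A hA using h
    refine ⟨(Finset.range (n + 1)).sup' ⟨0, by simp⟩ A, fun x => dsup_le_iff.2 fun i hi => ?_⟩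
    exact (hA i x).trans (Finset.le_sup' A (by simpa [Nat.lt_succ_iff] using hi))

/-- The underlying function of `ofBounds`. [folklore] -/
@[simp]
theorem ofBounds_apply (f : E → ℂ) (hf : ContDiff ℝ ∞ f)
    (h : ∀ n : ℕ, ∃ A : ℝ, ∀ x, ‖iteratedFDeriv ℝ n f x‖ ≤ A) (x : E) :
    ofBounds f hf h x = f x := rfl

/-- **Real cutoffs with bounded derivatives give cutoffs with bounded jets**: the bridge from
`exists_smooth_cutoff` (`SmoothCutoff`, real-valued `χ` with `‖Dⁿχ‖ ≤ Cₙ`) to `BddCutoff`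
(compose with the isometry `ℝ → ℂ`, which preserves the norms of all derivatives). [folklore] -/
def ofReal (χ : E → ℝ) (hχ : ContDiff ℝ ∞ χ)
    (h : ∀ n : ℕ, ∃ A : ℝ, ∀ x, ‖iteratedFDeriv ℝ n χ x‖ ≤ A) : BddCutoff E :=
  ofBounds (fun x => (χ x : ℂ)) (Complex.ofRealCLM.contDiff.comp hχ) fun n => by
    obtain ⟨A, hA⟩ := h n
    refine ⟨A, fun x => ?_⟩
    have : (fun x => (χ x : ℂ)) = Complex.ofRealLI ∘ χ := rfl
    rw [this, Complex.ofRealLI.norm_iteratedFDeriv_comp_left hχ.contDiffAt (mod_cast le_top)]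
    exact hA x

/-- Values of `ofReal`. [folklore] -/
@[simp]
theorem ofReal_apply (χ : E → ℝ) (hχ : ContDiff ℝ ∞ χ)
    (h : ∀ n : ℕ, ∃ A : ℝ, ∀ x, ‖iteratedFDeriv ℝ n χ x‖ ≤ A) (x : E) :
    ofReal χ hχ h x = (χ x : ℂ) := rfl

/-- A cutoff with bounded jets has temperate growth (with exponent `0`). [folklore] -/
theorem hasTemperateGrowth (χ : BddCutoff E) : Function.HasTemperateGrowth (χ : E → ℂ) := by
  refine ⟨χ.smooth, fun n => ?_⟩
  obtain ⟨A, hA⟩ := χ.bdd' n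
  refine ⟨0, A, fun x => ?_⟩
  simpa using (norm_iteratedFDeriv_le_dsup le_rfl χ.toFun x).trans (hA x)

/-- A nonnegative bound for the `n`-jet. [folklore] -/
theorem exists_dsup_le (χ : BddCutoff E) (n : ℕ) : ∃ A, 0 ≤ A ∧ ∀ x, dsup n χ x ≤ A := by
  obtain ⟨A, hA⟩ := χ.bdd' n
  exact ⟨max A 0, le_max_right _ _, fun x => (hA x).trans (le_max_left _ _)⟩

/-- **Admissibility** of a real-linear complex form `ℓ` for the cutoff `χ`: on the support of
`χ` the real part of `ℓ` decreases linearly, `Re ℓ(x) ≤ C₀ - c ‖x‖` with `c > 0` (so that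
`χ e^{ℓ}` is rapidly decreasing). [folklore] -/
def IsAdmissible (χ : BddCutoff E) (ℓ : E →L[ℝ] ℂ) : Prop :=
  ∃ c : ℝ, 0 < c ∧ ∃ C₀ : ℝ, ∀ x ∈ tsupport χ, (ℓ x).re ≤ C₀ - c * ‖x‖

/-- **Master estimate.** Let `χ` be a cutoff with bounded jets and `c > 0`, `C₀` real.
There is a constant `K` such that for every real-linear form `ℓ` with `Re ℓ ≤ C₀ - c ‖·‖` on the
support of `χ`, and every smooth `q` whose `n`-jet is bounded by `B (1 + ‖x‖)^m e^{(c/2)‖x‖}`, the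
weighted derivative `‖x‖^k ‖D^n (χ e^{ℓ} q)(x)‖` is at most `K (1 + ‖ℓ‖)^n B` everywhere (Leibniz +
chain rule + `e^{Re ℓ} ≤ e^{C₀} e^{-c‖x‖}` on `supp χ`). This is the computation behind
"`e^{-i⟨·,ζ⟩} χ ∈ 𝒮` with seminorms polynomial in `ζ`" in Hörmander's proof of Thm. 7.4.2.
[cite: HormanderALPDO1, §7.4 proof of Thm 7.4.2] -/
theorem master_estimate (χ : BddCutoff E) {c : ℝ} (hc : 0 < c) (C₀ : ℝ) (k n m : ℕ) :
    ∃ K : ℝ, 0 ≤ K ∧ ∀ (ℓ : E →L[ℝ] ℂ), (∀ x ∈ tsupport χ, (ℓ x).re ≤ C₀ - c * ‖x‖) →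
      ∀ (q : E → ℂ), ContDiff ℝ ∞ q → ∀ B : ℝ, 0 ≤ B →
        (∀ x, dsup n q x ≤ B * (1 + ‖x‖) ^ m * Real.exp (c / 2 * ‖x‖)) →
        ∀ x, ‖x‖ ^ k * ‖iteratedFDeriv ℝ n (fun y => χ y * cexp (ℓ y) * q y) x‖ ≤
          K * (1 + ‖ℓ‖) ^ n * B := by
  obtain ⟨A, hA0, hA⟩ := χ.exists_dsup_le n
  have hc2 : 0 < c / 2 := by positivity
  -- the constant
  refine ⟨4 ^ n * A * Real.exp C₀ *
      ((k + m).factorial / (c / 2) ^ (k + m) * Real.exp (c / 2)), by positivity, ?_⟩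
  intro ℓ hdec q hq B hB hqB x
  by_cases hx : x ∈ tsupport χ
  swap
  · -- off the support everything vanishes
    have h0 : iteratedFDeriv ℝ n (fun y => χ y * cexp (ℓ y) * q y) x = 0 := by
      have hx' : x ∉ tsupport (fun y => χ y * cexp (ℓ y) * q y) := fun h =>
        hx (tsupport_mul_subset_left (tsupport_mul_subset_left h))
      by_contra h
      exact hx' (support_iteratedFDeriv_subset n (Function.mem_support.2 h))
    rw [h0, norm_zero, mul_zero]
    positivity
  -- on the support: Leibniz twice
  have hsm1 : ContDiff ℝ ∞ fun y => χ y * cexp (ℓ y) := χ.smooth.mul (contDiff_cexp_comp ℓ)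
  have h1 : ‖iteratedFDeriv ℝ n (fun y => χ y * cexp (ℓ y) * q y) x‖
      ≤ dsup n (fun y => (χ y * cexp (ℓ y)) * q y) x := norm_iteratedFDeriv_le_dsup le_rfl _ x
  have h2 := dsup_mul_le hsm1 hq n x
  have h3 := dsup_mul_le χ.smooth (contDiff_cexp_comp ℓ) n x
  have h4 := dsup_cexp_comp_le ℓ n x
  have h5 : Real.exp (ℓ x).re ≤ Real.exp C₀ * Real.exp (-(c * ‖x‖)) := by
    rw [← Real.exp_add]; exact Real.exp_le_exp.2 (by linarith [hdec x hx])
  have hxk : ‖x‖ ^ k ≤ (1 + ‖x‖) ^ k := by gcongr; linarith [norm_nonneg x]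
  have hpoly := one_add_pow_mul_exp_neg_le hc2 (k + m) (norm_nonneg x)
  -- assemble
  have hdsq := hqB x
  have hd1 := dsup_nonneg n (fun y => χ y * cexp (ℓ y)) x
  have hdq := dsup_nonneg n q x
  have hdχ := dsup_nonneg n χ x
  have hde := dsup_nonneg n (fun y => cexp (ℓ y)) x
  calc ‖x‖ ^ k * ‖iteratedFDeriv ℝ n (fun y => χ y * cexp (ℓ y) * q y) x‖
      ≤ (1 + ‖x‖) ^ k * (2 ^ n * (2 ^ n * dsup n χ x * dsup n (fun y => cexp (ℓ y)) x)
          * dsup n q x) := by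
        gcongr
        exact h1.trans (h2.trans (by gcongr))
    _ ≤ (1 + ‖x‖) ^ k * (2 ^ n * (2 ^ n * A * ((1 + ‖ℓ‖) ^ n * (Real.exp C₀ * Real.exp (-(c * ‖x‖)))))
          * (B * (1 + ‖x‖) ^ m * Real.exp (c / 2 * ‖x‖))) := by
        gcongr
        · exact hA x
        · exact h4.trans (by gcongr)
    _ = 4 ^ n * A * Real.exp C₀ *
          ((1 + ‖x‖) ^ (k + m) * Real.exp (-(c / 2 * ‖x‖))) * (1 + ‖ℓ‖) ^ n * B := by
        rw [show (4 : ℝ) ^ n = 2 ^ n * 2 ^ n by rw [← mul_pow]; norm_num, pow_add]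
        have : Real.exp (-(c * ‖x‖)) * Real.exp (c / 2 * ‖x‖) = Real.exp (-(c / 2 * ‖x‖)) := by
          rw [← Real.exp_add]; congr 1; ring
        rw [← this]; ring
    _ ≤ 4 ^ n * A * Real.exp C₀ *
          ((k + m).factorial / (c / 2) ^ (k + m) * Real.exp (c / 2)) * (1 + ‖ℓ‖) ^ n * B := by
        gcongr

/-! ### The Schwartz functions `χ e^{ℓ} q` -/

/-- A function of temperate growth has jets bounded by a polynomial weight, uniformly up to
order `n` (deliberate dot-notation extension of Mathlib's `Function.HasTemperateGrowth`, stated in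
terms of the local `dsup`; it repackages `Function.HasTemperateGrowth.norm_iteratedFDeriv_le_uniform`).
[folklore] -/
theorem _root_.Function.HasTemperateGrowth.exists_dsup_le {q : E → F}
    (hq : q.HasTemperateGrowth) (n : ℕ) :
    ∃ m : ℕ, ∃ B : ℝ, 0 ≤ B ∧ ∀ x, dsup n q x ≤ B * (1 + ‖x‖) ^ m := by
  obtain ⟨k, C, hC, h⟩ := hq.norm_iteratedFDeriv_le_uniform n
  exact ⟨k, C, hC, fun x => dsup_le_iff.2 fun i hi => h i hi x⟩

open scoped Classical in
/-- **The rapidly decreasing function `χ e^{ℓ} q`.** For a cutoff `χ` with bounded jets, a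
real-linear complex form `ℓ` admissible for `χ` (`Re ℓ ≤ C₀ - c‖·‖` on `supp χ`, `c > 0`) and a
smooth `q` of temperate growth, `ξ ↦ χ(ξ) e^{ℓ ξ} q(ξ)` is a Schwartz function (master estimate);
for non-admissible `ℓ` the junk value `0` is returned. With `ℓ ξ = -i⟨ξ, ζ⟩`, `Im ζ` in the dual
cone, this is Hörmander's `e^{-i⟨·,ζ⟩} χ ∈ 𝒮`. [cite: HormanderALPDO1, §7.4 proof of Thm 7.4.2] -/
def expMul (χ : BddCutoff E) (ℓ : E →L[ℝ] ℂ) {q : E → ℂ} (hq : q.HasTemperateGrowth) :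
    𝓢(E, ℂ) :=
  if h : χ.IsAdmissible ℓ then
    { toFun := fun y => χ y * cexp (ℓ y) * q y
      smooth' := (χ.smooth.mul (contDiff_cexp_comp ℓ)).mul hq.1
      decay' := by
        intro k n
        obtain ⟨c, hc, C₀, hdec⟩ := h
        obtain ⟨m, B, hB, hqB⟩ := hq.exists_dsup_le n
        obtain ⟨K, _, hmain⟩ := χ.master_estimate hc C₀ k n m
        refine ⟨K * (1 + ‖ℓ‖) ^ n * B, fun x => hmain ℓ hdec q hq.1 B hB (fun x => ?_) x⟩
        exact (hqB x).trans (le_mul_of_one_le_right (by positivity)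
          (Real.one_le_exp (by positivity))) }
  else 0

/-- Pointwise values of `expMul` for admissible `ℓ`. [folklore] -/
theorem expMul_apply (χ : BddCutoff E) {ℓ : E →L[ℝ] ℂ} (h : χ.IsAdmissible ℓ) {q : E → ℂ}
    (hq : q.HasTemperateGrowth) (x : E) : χ.expMul ℓ hq x = χ x * cexp (ℓ x) * q x := by
  rw [expMul, dif_pos h]; rfl

/-- The underlying function of `expMul` for admissible `ℓ`. [folklore] -/
theorem coe_expMul (χ : BddCutoff E) {ℓ : E →L[ℝ] ℂ} (h : χ.IsAdmissible ℓ) {q : E → ℂ}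
    (hq : q.HasTemperateGrowth) : ⇑(χ.expMul ℓ hq) = fun x => χ x * cexp (ℓ x) * q x :=
  funext fun x => χ.expMul_apply h hq x

/-- `expMul` is the zero function for non-admissible `ℓ`. [folklore] -/
theorem expMul_of_not (χ : BddCutoff E) {ℓ : E →L[ℝ] ℂ} (h : ¬ χ.IsAdmissible ℓ) {q : E → ℂ}
    (hq : q.HasTemperateGrowth) : χ.expMul ℓ hq = 0 := by
  rw [expMul, dif_neg h]

/-- The support of `expMul` lies in the support of the cutoff. [folklore] -/
theorem tsupport_expMul_subset (χ : BddCutoff E) (ℓ : E →L[ℝ] ℂ) {q : E → ℂ}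
    (hq : q.HasTemperateGrowth) : tsupport (χ.expMul ℓ hq) ⊆ tsupport χ := by
  by_cases h : χ.IsAdmissible ℓ
  · rw [coe_expMul χ h hq]
    exact (tsupport_mul_subset_left).trans tsupport_mul_subset_left
  · rw [expMul_of_not χ h hq]
    intro x hx
    have h0 : ((0 : 𝓢(E, ℂ)) : E → ℂ) = 0 := by ext y; simp
    rw [h0] at hx
    simp [tsupport] at hx

variable {𝕜 : Type*} [NormedField 𝕜] [NormedSpace 𝕜 ℂ] [SMulCommClass ℝ 𝕜 ℂ]

/-- **Seminorm bound for `χ e^{ℓ} q`** (master estimate, uniform in `ℓ` and linear in the jet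
bound `B` of `q`): `p_{k,n}(χ e^{ℓ} q) ≤ K (1 + ‖ℓ‖)^n B`. [cite: HormanderALPDO1, §7.4 proof of Thm 7.4.2] -/
theorem seminorm_expMul_le (χ : BddCutoff E) {c : ℝ} (hc : 0 < c) (C₀ : ℝ) (k n m : ℕ) :
    ∃ K : ℝ, 0 ≤ K ∧ ∀ (ℓ : E →L[ℝ] ℂ), (∀ x ∈ tsupport χ, (ℓ x).re ≤ C₀ - c * ‖x‖) →
      ∀ (q : E → ℂ) (hq : q.HasTemperateGrowth) (B : ℝ), 0 ≤ B →
        (∀ x, dsup n q x ≤ B * (1 + ‖x‖) ^ m) →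
        SchwartzMap.seminorm 𝕜 k n (χ.expMul ℓ hq) ≤ K * (1 + ‖ℓ‖) ^ n * B := by
  obtain ⟨K, hK, hmain⟩ := χ.master_estimate hc C₀ k n m
  refine ⟨K, hK, fun ℓ hdec q hq B hB hqB => ?_⟩
  have hadm : χ.IsAdmissible ℓ := ⟨c, hc, C₀, hdec⟩
  refine SchwartzMap.seminorm_le_bound 𝕜 k n _ (by positivity) fun x => ?_
  rw [coe_expMul χ hadm hq]
  exact hmain ℓ hdec q hq.1 B hB (fun x => (hqB x).trans
    (le_mul_of_one_le_right (by positivity) (Real.one_le_exp (by positivity)))) x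

/-! ### Continuous linear functionals on `𝓢` are controlled by finitely many seminorms -/

omit [NormedSpace 𝕜 ℂ] [SMulCommClass ℝ 𝕜 ℂ] in
/-- A continuous linear map out of Schwartz space into a normed space is bounded by a finite
sum of Schwartz seminorms. [folklore] -/
theorem exists_seminorm_bound_of_clm {𝕜' : Type*} [RCLike 𝕜']
    {D : Type*} [NormedAddCommGroup D] [NormedSpace ℝ D]
    {V : Type*} [NormedAddCommGroup V] [NormedSpace ℝ V] [NormedSpace 𝕜' V] [SMulCommClass ℝ 𝕜' V]
    {G : Type*} [NormedAddCommGroup G] [NormedSpace 𝕜' G] (U : 𝓢(D, V) →L[𝕜'] G) :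
    ∃ (s : Finset (ℕ × ℕ)) (C : ℝ), 0 ≤ C ∧
      ∀ f, ‖U f‖ ≤ C * ∑ i ∈ s, SchwartzMap.seminorm 𝕜' i.1 i.2 f := by
  let qU : Seminorm 𝕜' 𝓢(D, V) := (normSeminorm 𝕜' G).comp (U : 𝓢(D, V) →ₗ[𝕜'] G)
  have hq : Continuous qU := continuous_norm.comp U.continuous
  obtain ⟨s, C, _, hle⟩ := Seminorm.bound_of_continuous (schwartz_withSeminorms 𝕜' D V) qU hq
  refine ⟨s, C, C.2, fun f => ?_⟩
  have h1 : ‖U f‖ ≤ C * (s.sup (schwartzSeminormFamily 𝕜' D V)) f := hle f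
  refine h1.trans ?_
  gcongr
  refine ((Seminorm.finset_sup_le_sum (schwartzSeminormFamily 𝕜' D V) s) f).trans_eq ?_
  change FunLike.coeAddMonoidHom _ _ _ (∑ i ∈ s, schwartzSeminormFamily 𝕜' D V i) f = _
  rw [map_sum, Finset.sum_apply]
  rfl

/-! ### Differentiating `χ e^{Λ p}` in the parameter through a continuous functional -/

variable {P : Type*} [NormedAddCommGroup P] [NormedSpace ℂ P]

/-- The **exponential family** `p ↦ χ e^{Λ p}` attached to a `ℂ`-linear family of real-linear
complex forms `Λ : P →L[ℂ] (E →L[ℝ] ℂ)` (for the Fourier–Laplace transform,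
`Λ ζ = (ξ ↦ -i⟨ξ, ζ⟩)`). [folklore] -/
def expFamily (χ : BddCutoff E) (Λ : P →L[ℂ] (E →L[ℝ] ℂ)) (p : P) : 𝓢(E, ℂ) :=
  χ.expMul (Λ p) (Function.HasTemperateGrowth.const (1 : ℂ))

/-- Values of the exponential family at admissible parameters. [folklore] -/
theorem expFamily_apply (χ : BddCutoff E) (Λ : P →L[ℂ] (E →L[ℝ] ℂ)) {p : P}
    (h : χ.IsAdmissible (Λ p)) (x : E) : χ.expFamily Λ p x = χ x * cexp (Λ p x) := by
  simp [expFamily, expMul_apply χ h]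

/-- **Seminorm bound for the exponential family**: `p_{k,n}(χ e^{Λ p}) ≤ K (1 + ‖Λ p‖)^n`
uniformly over parameters `p` whose form obeys a fixed decay `Re Λ p ≤ C₀ - c‖·‖` on `supp χ`
(master estimate with `q = 1`). Polynomial growth of the Fourier–Laplace transform in `Re ζ`
(Hörmander Thm. 7.4.2, estimate (7.4.5) with `M` a point). [cite: HormanderALPDO1, Thm 7.4.2] -/
theorem seminorm_expFamily_le (χ : BddCutoff E) (Λ : P →L[ℂ] (E →L[ℝ] ℂ)) {c : ℝ} (hc : 0 < c)
    (C₀ : ℝ) (k n : ℕ) :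
    ∃ K : ℝ, 0 ≤ K ∧ ∀ p : P, (∀ x ∈ tsupport χ, (Λ p x).re ≤ C₀ - c * ‖x‖) →
      SchwartzMap.seminorm 𝕜 k n (χ.expFamily Λ p) ≤ K * (1 + ‖Λ p‖) ^ n := by
  obtain ⟨K, hK, h⟩ := χ.seminorm_expMul_le (𝕜 := 𝕜) hc C₀ k n 0
  refine ⟨K, hK, fun p hp => ?_⟩
  have := h (Λ p) hp (fun _ => (1 : ℂ)) (Function.HasTemperateGrowth.const 1) 1 zero_le_one
    (fun x => by simpa using dsup_const_le n (1 : ℂ) x)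
  simpa [expFamily] using this

/-- The would-be derivative of the exponential family at `p₀`: `w ↦ χ e^{Λ p₀} (Λ w)`, as a
linear map (continuity below, in finite dimension). [folklore] -/
def expFamilyDerivₗ (χ : BddCutoff E) (Λ : P →L[ℂ] (E →L[ℝ] ℂ)) (p₀ : P) : P →ₗ[ℂ] 𝓢(E, ℂ) where
  toFun w := χ.expMul (Λ p₀) (Λ w).hasTemperateGrowth
  map_add' w₁ w₂ := by
    by_cases h : χ.IsAdmissible (Λ p₀)
    · ext x
      simp only [add_apply, expMul_apply χ h, map_add]
      ring
    · simp [expMul_of_not χ h]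
  map_smul' a w := by
    by_cases h : χ.IsAdmissible (Λ p₀)
    · ext x
      simp only [smul_apply, expMul_apply χ h, map_smul, FunLike.coe_smul,
        Pi.smul_apply, RingHom.id_apply, smul_eq_mul]
      ring
    · simp [expMul_of_not χ h]

/-- The derivative of the exponential family at `p₀` as a continuous linear map (finite
dimensional parameter space). [folklore] -/
def expFamilyDeriv [FiniteDimensional ℂ P] (χ : BddCutoff E) (Λ : P →L[ℂ] (E →L[ℝ] ℂ)) (p₀ : P) :
    P →L[ℂ] 𝓢(E, ℂ) :=
  ⟨χ.expFamilyDerivₗ Λ p₀, LinearMap.continuous_of_finiteDimensional _⟩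

/-- Values of the derivative map. [folklore] -/
theorem expFamilyDeriv_apply [FiniteDimensional ℂ P] (χ : BddCutoff E) (Λ : P →L[ℂ] (E →L[ℝ] ℂ))
    (p₀ w : P) : χ.expFamilyDeriv Λ p₀ w = χ.expMul (Λ p₀) (Λ w).hasTemperateGrowth := rfl

/-- Admissibility is stable under small perturbations of the form (with half the decay rate). [folklore] -/
theorem isAdmissible_add_of_norm_le (χ : BddCutoff E) {ℓ : E →L[ℝ] ℂ} {c C₀ : ℝ}
    (hdec : ∀ x ∈ tsupport χ, (ℓ x).re ≤ C₀ - c * ‖x‖) {ℓ' : E →L[ℝ] ℂ} (hℓ' : ‖ℓ'‖ ≤ c / 2) :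
    ∀ x ∈ tsupport χ, ((ℓ + ℓ') x).re ≤ C₀ - c / 2 * ‖x‖ := by
  intro x hx
  have h1 := hdec x hx
  have h2 : (ℓ' x).re ≤ c / 2 * ‖x‖ :=
    (Complex.re_le_norm _).trans ((ℓ'.le_opNorm x).trans (by gcongr))
  rw [add_apply, Complex.add_re]
  linarith

/-- **The exponential family is differentiable through any continuous functional**, with
derivative `w ↦ U(χ e^{Λ p₀} Λ w)`: the second-order Taylor remainder
`χ e^{Λ p₀}(e^{Λ w} - 1 - Λ w)` has all Schwartz seminorms `O(‖w‖²)` by the master estimate.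
This is the holomorphy of the Fourier–Laplace transform `ζ ↦ û(ζ) = ⟨u, e^{-i⟨·,ζ⟩} χ⟩`
(Hörmander Thm. 7.4.2: "an analytic function `û` in `ℝⁿ + iΓ°`"). [cite: HormanderALPDO1, Thm 7.4.2] -/
theorem hasFDerivAt_comp_expFamily [FiniteDimensional ℂ P] (χ : BddCutoff E)
    (Λ : P →L[ℂ] (E →L[ℝ] ℂ)) {p₀ : P} (h : χ.IsAdmissible (Λ p₀))
    {G : Type*} [NormedAddCommGroup G] [NormedSpace ℂ G] (U : 𝓢(E, ℂ) →L[ℂ] G) :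
    HasFDerivAt (fun p => U (χ.expFamily Λ p)) (U ∘L χ.expFamilyDeriv Λ p₀) p₀ := by
  obtain ⟨c, hc, C₀, hdec⟩ := h
  obtain ⟨s, CU, hCU, hU⟩ := exists_seminorm_bound_of_clm U
  -- one master constant per seminorm index in `s`
  have hK : ∀ i : ℕ × ℕ, ∃ K : ℝ, 0 ≤ K ∧ ∀ (ℓ : E →L[ℝ] ℂ),
      (∀ x ∈ tsupport χ, (ℓ x).re ≤ C₀ - c * ‖x‖) →
      ∀ (q : E → ℂ), ContDiff ℝ ∞ q → ∀ B : ℝ, 0 ≤ B →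
        (∀ x, dsup i.2 q x ≤ B * (1 + ‖x‖) ^ 2 * Real.exp (c / 2 * ‖x‖)) →
        ∀ x, ‖x‖ ^ i.1 * ‖iteratedFDeriv ℝ i.2 (fun y => χ y * cexp (ℓ y) * q y) x‖ ≤
          K * (1 + ‖ℓ‖) ^ i.2 * B :=
    fun i => χ.master_estimate hc C₀ i.1 i.2 2
  choose K hK0 hKmain using hK
  -- radius on which `Λ w` is small
  set δ : ℝ := c / 2 / (‖Λ‖ + 1) with hδ
  have hδpos : 0 < δ := by positivity
  have hΛw : ∀ w : P, ‖w‖ ≤ δ → ‖Λ w‖ ≤ c / 2 := by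
    intro w hw
    calc ‖Λ w‖ ≤ ‖Λ‖ * ‖w‖ := Λ.le_opNorm w
      _ ≤ (‖Λ‖ + 1) * δ := by gcongr; linarith
      _ = c / 2 := by rw [hδ]; field_simp
  -- the remainder as a Schwartz map and its pointwise form
  set N : ℕ := s.sup fun i => i.2 with hN
  set Ktot : ℝ := CU * ∑ i ∈ s, K i * (1 + ‖Λ p₀‖) ^ i.2 * (‖Λ‖ ^ 2 * (1 + c / 2) ^ N) with hKtot
  have hN' : ∀ i ∈ s, i.2 ≤ N := fun i hi => Finset.le_sup (f := fun i : ℕ × ℕ => i.2) hi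
  -- the quadratic bound on a ball
  have hbig : ∀ w : P, ‖w‖ ≤ δ →
      ‖U (χ.expFamily Λ (p₀ + w)) - U (χ.expFamily Λ p₀) - (U ∘L χ.expFamilyDeriv Λ p₀) w‖ ≤
        Ktot * ‖w‖ ^ 2 := by
    intro w hw
    have hw' := hΛw w hw
    have hadm0 : χ.IsAdmissible (Λ p₀) := ⟨c, hc, C₀, hdec⟩
    have hadm : χ.IsAdmissible (Λ (p₀ + w)) := by
      refine ⟨c / 2, by positivity, C₀, ?_⟩
      rw [map_add]
      exact χ.isAdmissible_add_of_norm_le hdec hw'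
    -- the remainder
    set R : 𝓢(E, ℂ) := χ.expFamily Λ (p₀ + w) - χ.expFamily Λ p₀ - χ.expFamilyDeriv Λ p₀ w with hR
    have hRU : U (χ.expFamily Λ (p₀ + w)) - U (χ.expFamily Λ p₀) - (U ∘L χ.expFamilyDeriv Λ p₀) w
        = U R := by simp [hR]
    have hRcoe : (R : E → ℂ) = fun x => χ x * cexp (Λ p₀ x) * (cexp (Λ w x) - 1 - Λ w x) := by
      ext x
      simp only [hR, sub_apply, expFamily_apply χ Λ hadm, expFamily_apply χ Λ hadm0,
        expFamilyDeriv_apply, expMul_apply χ hadm0, map_add, add_apply, Complex.exp_add]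
      ring
    -- seminorm bounds for `R`
    have hsemi : ∀ i ∈ s, SchwartzMap.seminorm ℂ i.1 i.2 R ≤
        K i * (1 + ‖Λ p₀‖) ^ i.2 * (‖Λ‖ ^ 2 * (1 + c / 2) ^ N) * ‖w‖ ^ 2 := by
      intro i hi
      have hq : ContDiff ℝ ∞ fun y => cexp (Λ w y) - 1 - Λ w y :=
        (contDiff_cexp_sub_one_sub.restrict_scalars ℝ).comp (Λ w).contDiff
      set B : ℝ := ‖Λ w‖ ^ 2 * (1 + ‖Λ w‖) ^ i.2 with hB
      have hB0 : 0 ≤ B := by positivity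
      have hqB : ∀ x, dsup i.2 (fun y => cexp (Λ w y) - 1 - Λ w y) x ≤
          B * (1 + ‖x‖) ^ 2 * Real.exp (c / 2 * ‖x‖) := by
        intro x
        refine (dsup_cexp_sub_one_sub_comp_le (Λ w) i.2 x).trans ?_
        rw [hB]
        have : Real.exp (‖Λ w‖ * ‖x‖) ≤ Real.exp (c / 2 * ‖x‖) := Real.exp_le_exp.2 (by gcongr)
        calc ‖Λ w‖ ^ 2 * (1 + ‖x‖) ^ 2 * (1 + ‖Λ w‖) ^ i.2 * Real.exp (‖Λ w‖ * ‖x‖)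
            = ‖Λ w‖ ^ 2 * (1 + ‖Λ w‖) ^ i.2 * (1 + ‖x‖) ^ 2 * Real.exp (‖Λ w‖ * ‖x‖) := by ring
          _ ≤ ‖Λ w‖ ^ 2 * (1 + ‖Λ w‖) ^ i.2 * (1 + ‖x‖) ^ 2 * Real.exp (c / 2 * ‖x‖) := by gcongr
      have h1 : SchwartzMap.seminorm ℂ i.1 i.2 R ≤ K i * (1 + ‖Λ p₀‖) ^ i.2 * B := by
        refine SchwartzMap.seminorm_le_bound ℂ i.1 i.2 R
          (mul_nonneg (mul_nonneg (hK0 i) (by positivity)) hB0) fun x => ?_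
        rw [hRcoe]
        exact hKmain i (Λ p₀) hdec _ hq B hB0 hqB x
      refine h1.trans ?_
      have h2 : B ≤ (‖Λ‖ ^ 2 * (1 + c / 2) ^ N) * ‖w‖ ^ 2 := by
        rw [hB]
        calc ‖Λ w‖ ^ 2 * (1 + ‖Λ w‖) ^ i.2 ≤ (‖Λ‖ * ‖w‖) ^ 2 * (1 + c / 2) ^ i.2 := by
              gcongr; exact Λ.le_opNorm w
          _ ≤ (‖Λ‖ * ‖w‖) ^ 2 * (1 + c / 2) ^ N :=
              mul_le_mul_of_nonneg_left (pow_le_pow_right₀ (by linarith) (hN' i hi)) (by positivity)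
          _ = (‖Λ‖ ^ 2 * (1 + c / 2) ^ N) * ‖w‖ ^ 2 := by ring
      calc K i * (1 + ‖Λ p₀‖) ^ i.2 * B
          ≤ K i * (1 + ‖Λ p₀‖) ^ i.2 * ((‖Λ‖ ^ 2 * (1 + c / 2) ^ N) * ‖w‖ ^ 2) := by
            gcongr; exact mul_nonneg (hK0 i) (by positivity)
        _ = _ := by ring
    rw [hRU]
    refine (hU R).trans ?_
    rw [hKtot]
    calc CU * ∑ i ∈ s, SchwartzMap.seminorm ℂ i.1 i.2 R
        ≤ CU * ∑ i ∈ s, K i * (1 + ‖Λ p₀‖) ^ i.2 * (‖Λ‖ ^ 2 * (1 + c / 2) ^ N) * ‖w‖ ^ 2 := by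
          gcongr with i hi; exact hsemi i hi
      _ = _ := by rw [← Finset.sum_mul]; ring
  -- conclude: `O(‖w‖²) = o(w)`
  rw [hasFDerivAt_iff_isLittleO_nhds_zero]
  have hO : (fun w : P => U (χ.expFamily Λ (p₀ + w)) - U (χ.expFamily Λ p₀) -
      (U ∘L χ.expFamilyDeriv Λ p₀) w) =O[𝓝 0] fun w : P => ‖w‖ ^ 2 := by
    refine IsBigO.of_bound Ktot ?_
    rw [Metric.eventually_nhds_iff]
    refine ⟨δ, hδpos, fun w hw => ?_⟩
    rw [Real.norm_of_nonneg (by positivity)]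
    exact hbig w (by simpa [dist_zero_right] using hw.le)
  exact hO.trans_isLittleO (isLittleO_norm_pow_id one_lt_two)
/-! ### Switching the exponential weight on: `χ (e^{tℓ} - 1) g = O(t)` in `𝓢` -/

/-- Jet of `e^{tℓ} - 1` at a point where `Re ℓ ≤ C₀`: every derivative is `O(t)`, uniformly for
`t ∈ [0, 1]`: `dsup n (e^{tℓ} - 1)(x) ≤ t e^{max(C₀,0)} (1 + ‖ℓ‖)^{n+1} (1 + ‖x‖)`. [folklore] -/
theorem dsup_cexp_smul_sub_one_le (ℓ : E →L[ℝ] ℂ) {C₀ : ℝ} {x : E} (hx : (ℓ x).re ≤ C₀)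
    {t : ℝ} (ht0 : 0 ≤ t) (ht1 : t ≤ 1) (n : ℕ) :
    dsup n (fun y => cexp ((t • ℓ) y) - 1) x ≤
      t * Real.exp (max C₀ 0) * (1 + ‖ℓ‖) ^ (n + 1) * (1 + ‖x‖) := by
  have hℓ := norm_nonneg ℓ
  have hxn := norm_nonneg x
  have h1ℓ : (1 : ℝ) ≤ 1 + ‖ℓ‖ := by linarith
  have htℓ : ‖t • ℓ‖ = t * ‖ℓ‖ := by rw [norm_smul, Real.norm_of_nonneg ht0]
  have hs : (t • ℓ) x = (t : ℂ) * ℓ x := by simp [Complex.real_smul]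
  have hre : ((t • ℓ) x).re ≤ max C₀ 0 := by
    rw [hs, Complex.re_ofReal_mul]
    rcases le_or_gt 0 C₀ with h | h
    · calc t * (ℓ x).re ≤ t * C₀ := by gcongr
        _ ≤ 1 * C₀ := by gcongr
        _ = max C₀ 0 := by simp [max_eq_left h]
    · calc t * (ℓ x).re ≤ 0 := by nlinarith
        _ = max C₀ 0 := by simp [max_eq_right h.le]
  have hns : ‖(t • ℓ) x‖ ≤ t * ‖ℓ‖ * ‖x‖ := by
    calc ‖(t • ℓ) x‖ ≤ ‖t • ℓ‖ * ‖x‖ := (t • ℓ).le_opNorm x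
      _ = t * ‖ℓ‖ * ‖x‖ := by rw [htℓ]
  refine dsup_le_iff.2 fun i hi => ?_
  refine (norm_iteratedFDeriv_comp_clm_le contDiff_cexp_sub_one (t • ℓ) i x).trans ?_
  rw [iteratedDeriv_cexp_sub_one, htℓ]
  split_ifs with h0
  · subst h0
    simp only [pow_zero, mul_one]
    refine (norm_cexp_sub_one_le _).trans ?_
    calc ‖(t • ℓ) x‖ * Real.exp (max ((t • ℓ) x).re 0)
        ≤ (t * ‖ℓ‖ * ‖x‖) * Real.exp (max C₀ 0) :=
          mul_le_mul hns (Real.exp_le_exp.2 (max_le hre (le_max_right _ _))) (by positivity)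
            (by positivity)
      _ = t * Real.exp (max C₀ 0) * ‖ℓ‖ * ‖x‖ := by ring
      _ ≤ t * Real.exp (max C₀ 0) * (1 + ‖ℓ‖) ^ (n + 1) * (1 + ‖x‖) := by
          gcongr
          · calc ‖ℓ‖ ≤ (1 + ‖ℓ‖) ^ 1 := by linarith
              _ ≤ (1 + ‖ℓ‖) ^ (n + 1) := pow_le_pow_right₀ h1ℓ (by omega)
          · linarith
  · obtain ⟨j, rfl⟩ : ∃ j, i = j + 1 := ⟨i - 1, by omega⟩
    rw [Complex.norm_exp]
    have htj : t ^ (j + 1) ≤ t := by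
      rw [pow_succ]
      exact mul_le_of_le_one_left ht0 (pow_le_one₀ ht0 ht1)
    calc Real.exp ((t • ℓ) x).re * (t * ‖ℓ‖) ^ (j + 1)
        = t ^ (j + 1) * Real.exp ((t • ℓ) x).re * ‖ℓ‖ ^ (j + 1) * 1 := by ring
      _ ≤ t * Real.exp (max C₀ 0) * (1 + ‖ℓ‖) ^ (n + 1) * (1 + ‖x‖) := by
          gcongr
          · calc ‖ℓ‖ ^ (j + 1) ≤ (1 + ‖ℓ‖) ^ (j + 1) := by gcongr; linarith
              _ ≤ (1 + ‖ℓ‖) ^ (n + 1) := pow_le_pow_right₀ h1ℓ (by omega)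
          · linarith

/-- The weighted jet of a Schwartz function is controlled by one sup-seminorm:
`(1 + ‖x‖)^k dsup n g x ≤ 2^k sup_{(k',n') ≤ (k,n)} p_{k',n'}(g)`. [folklore] -/
theorem one_add_pow_mul_dsup_le (k n : ℕ) (g : 𝓢(E, ℂ)) (x : E) :
    (1 + ‖x‖) ^ k * dsup n g x ≤
      2 ^ k * (Finset.Iic (k, n)).sup (schwartzSeminormFamily 𝕜 E ℂ) g := by
  have hpos : 0 < (1 + ‖x‖) ^ k := by positivity
  rw [mul_comm, ← le_div_iff₀ hpos]
  refine dsup_le_iff.2 fun i hi => ?_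
  rw [le_div_iff₀ hpos, mul_comm]
  exact SchwartzMap.one_add_le_sup_seminorm_apply (m := (k, n)) le_rfl hi g x

/-- **Switching on the exponential weight costs `O(t)` in every Schwartz seminorm.** For a cutoff
`χ` with bounded jets, a form `ℓ` with `Re ℓ ≤ C₀ - c‖·‖` (`c ≥ 0`) on `supp χ`, a Schwartz
function `g` and `t ∈ [0, 1]`:
`‖x‖^k ‖D^n(χ (e^{tℓ} - 1) g)(x)‖ ≤ t · K (1 + ‖ℓ‖)^{n+1} · sup_{≤ (k+1, n)} p(g)`. This is the
`𝒮'`-convergence `û(· + itθ) → 𝓕u` of the Remark after Hörmander's Thm. 7.4.3, on the test-function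
side. [cite: HormanderALPDO1, §7.4 Remark after Thm 7.4.3] -/
theorem pow_mul_norm_iteratedFDeriv_cexp_sub_one_mul_le (χ : BddCutoff E) {c : ℝ} (hc : 0 ≤ c)
    (C₀ : ℝ) (k n : ℕ) :
    ∃ K : ℝ, 0 ≤ K ∧ ∀ (ℓ : E →L[ℝ] ℂ), (∀ x ∈ tsupport χ, (ℓ x).re ≤ C₀ - c * ‖x‖) →
      ∀ (g : 𝓢(E, ℂ)) (t : ℝ), 0 ≤ t → t ≤ 1 →
        ∀ x, ‖x‖ ^ k * ‖iteratedFDeriv ℝ n (fun y => χ y * (cexp ((t • ℓ) y) - 1) * g y) x‖ ≤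
          t * (K * (1 + ‖ℓ‖) ^ (n + 1) *
            (Finset.Iic (k + 1, n)).sup (schwartzSeminormFamily 𝕜 E ℂ) g) := by
  obtain ⟨A, hA0, hA⟩ := χ.exists_dsup_le n
  refine ⟨4 ^ n * A * Real.exp (max C₀ 0) * 2 ^ (k + 1), by positivity, ?_⟩
  intro ℓ hdec g t ht0 ht1 x
  set S : ℝ := (Finset.Iic (k + 1, n)).sup (schwartzSeminormFamily 𝕜 E ℂ) g with hS
  have hS0 : 0 ≤ S := apply_nonneg _ _
  by_cases hx : x ∈ tsupport χ
  swap
  · have h0 : iteratedFDeriv ℝ n (fun y => χ y * (cexp ((t • ℓ) y) - 1) * g y) x = 0 := by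
      have hx' : x ∉ tsupport (fun y => χ y * (cexp ((t • ℓ) y) - 1) * g y) := fun h =>
        hx (tsupport_mul_subset_left (tsupport_mul_subset_left h))
      by_contra h
      exact hx' (support_iteratedFDeriv_subset n (Function.mem_support.2 h))
    rw [h0, norm_zero, mul_zero]
    positivity
  have hsme : ContDiff ℝ ∞ fun y => cexp ((t • ℓ) y) - 1 :=
    (contDiff_cexp_sub_one.restrict_scalars ℝ).comp (t • ℓ).contDiff
  have hsm1 : ContDiff ℝ ∞ fun y => χ y * (cexp ((t • ℓ) y) - 1) := χ.smooth.mul hsme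
  have h1 : ‖iteratedFDeriv ℝ n (fun y => χ y * (cexp ((t • ℓ) y) - 1) * g y) x‖
      ≤ dsup n (fun y => (χ y * (cexp ((t • ℓ) y) - 1)) * g y) x :=
    norm_iteratedFDeriv_le_dsup le_rfl _ x
  have h2 := dsup_mul_le hsm1 (g.smooth ⊤) n x
  have h3 := dsup_mul_le χ.smooth hsme n x
  have hC₀ : (ℓ x).re ≤ C₀ := (hdec x hx).trans (by nlinarith [norm_nonneg x])
  have h4 := dsup_cexp_smul_sub_one_le ℓ hC₀ ht0 ht1 n
  have h5 := one_add_pow_mul_dsup_le (𝕜 := 𝕜) (k + 1) n g x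
  have hxk : ‖x‖ ^ k * (1 + ‖x‖) ≤ (1 + ‖x‖) ^ (k + 1) := by
    rw [pow_succ]; gcongr; linarith [norm_nonneg x]
  have hdg := dsup_nonneg n g x
  have hdχ := dsup_nonneg n χ x
  calc ‖x‖ ^ k * ‖iteratedFDeriv ℝ n (fun y => χ y * (cexp ((t • ℓ) y) - 1) * g y) x‖
      ≤ ‖x‖ ^ k * (2 ^ n * (2 ^ n * dsup n χ x * dsup n (fun y => cexp ((t • ℓ) y) - 1) x)
          * dsup n g x) := by
        gcongr
        exact h1.trans (h2.trans (by gcongr))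
    _ ≤ ‖x‖ ^ k * (2 ^ n * (2 ^ n * A *
          (t * Real.exp (max C₀ 0) * (1 + ‖ℓ‖) ^ (n + 1) * (1 + ‖x‖))) * dsup n g x) := by
        have hinner : 2 ^ n * dsup n χ x * dsup n (fun y => cexp ((t • ℓ) y) - 1) x
            ≤ 2 ^ n * A * (t * Real.exp (max C₀ 0) * (1 + ‖ℓ‖) ^ (n + 1) * (1 + ‖x‖)) := by
          rw [mul_assoc, mul_assoc]
          exact mul_le_mul_of_nonneg_left (mul_le_mul (hA x) h4 (dsup_nonneg _ _ _) hA0)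
            (by positivity)
        exact mul_le_mul_of_nonneg_left (mul_le_mul_of_nonneg_right
          (mul_le_mul_of_nonneg_left hinner (by positivity)) hdg) (by positivity)
    _ = 4 ^ n * A * Real.exp (max C₀ 0) * t * (1 + ‖ℓ‖) ^ (n + 1) *
          ((‖x‖ ^ k * (1 + ‖x‖)) * dsup n g x) := by
        rw [show (4 : ℝ) ^ n = 2 ^ n * 2 ^ n by rw [← mul_pow]; norm_num]; ring
    _ ≤ 4 ^ n * A * Real.exp (max C₀ 0) * t * (1 + ‖ℓ‖) ^ (n + 1) *
          ((1 + ‖x‖) ^ (k + 1) * dsup n g x) := by gcongr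
    _ ≤ 4 ^ n * A * Real.exp (max C₀ 0) * t * (1 + ‖ℓ‖) ^ (n + 1) * (2 ^ (k + 1) * S) := by
        gcongr
    _ = _ := by ring

end BddCutoff

end Literature.Analysis.Distribution
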